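import Literature.NumberTheory.Automorphic.VarmaLocalGlobalPrecI
import Literature.NumberTheory.Automorphic.LocalComponentBJUniqueProofs
import Literature.NumberTheory.Automorphic.GaloisActionPlaces
import Summits.Langlands.Langlands.Theorems.IrreducibilityBySelfDualityIrreducibleOffSectorWDIrreducibleBasics
import Summits.Langlands.Langlands.Theorems.IrreducibilityBySelfDualityIrreducibleOffSectorA1IndecomposableWD
import Summits.Langlands.Langlands.Theorems.IrreducibilityBySelfDualityIrreducibleOffSectorL4IndecomposableDescent
import HarnessLib

/-!
# Region B: a POLARIZED attached Galois representation is irreducible at a place with an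
# INDECOMPOSABLE parameter away from `ℓ` (Taylor–Yoshida Cor 1.3)
(crux stmt-Langlands-14329 `IrreducibilityBySelfDuality.IrreducibleOffSector`, supports kit
`square-integrable-place` §3 `region_polarized_indecomposablePlace`; `--supports` file, lead a1)

For a family `𝓛 = (𝓛_v)_v` of local Langlands data of the completions of the CM field `K`
satisfying (C) Caraiani 2012 Thm 1.1 keyed to `𝓛` (twisted local–global compatibility WITH
monodromy at every `v ∤ ℓ` for conjugate-self-dual regular algebraic cuspidal `π'`: the
Frobenius-semisimplification of `ι(WD(r|_{Γ_{K_v}}))` has class `rec_v(π'_v ⊗ |det|^{(1-n)/2})`),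
every semisimple `r` attached to such a `π'` is IRREDUCIBLE as soon as, at some `v ∤ ℓ`, every
Frobenius-semisimple representative of `rec_v(π'_v ⊗ |det|^{(1-n)/2})` is indecomposable
(`π'_v` essentially square-integrable): the indecomposable class representative is a
Frobenius-semisimplification `Wℂ'` of `Wℂ = ι(W)` (C, local components being unique up to
isomorphism, `AutomorphicRepData.hasLocalComponentAt_unique_holds`), so `W` is indecomposable
(L4) and `r` irreducible (A1-ind, using semisimplicity).  All hypotheses are stated inline (kit
names `CaraianiLGCFor`, `IsConjSelfDualSatake`, `AttachedLGCAt`, `IsAttached`,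
`HasIndecomposableParameterAt`).
References: Taylor–Yoshida, arXiv:math/0412357, Cor 1.3; Caraiani, arXiv:1010.2188, Thm 1.1.
-/

noncomputable section

set_option linter.dupNamespace false

open scoped MatrixGroups Matrix NumberField
open Module IsDedekindDomain NumberField Filter
open Literature.NumberTheory.Automorphic Literature.NumberTheory.GaloisRepresentations

namespace Summit.Langlands.Langlands.Theorems.IrreducibleOffSector.SquareIntegrablePlace

/-- **Region B (polarized, indecomposable-parameter place away from `ℓ`) — every `ι`.**
[cite: TaylorYoshida2007, Cor. 1.3] [cite: Caraiani2012, Thm. 1.1] -/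
theorem region_polarized_indecomposablePlace {K : Type} [Field K] [NumberField K]
    (𝓛 : ∀ v : HeightOneSpectrum (𝓞 K), LocalLanglandsDatum (v.adicCompletion K))
    (hC : IsCMField K → ∀ {n : ℕ} (hcpt : isCompact_glFiniteIntegralLevel n K)
      (π' : CuspidalAutomorphicRepData n K hcpt), π'.1.IsRegularAlgebraic →
      (∃ (c : K ≃ₐ[ℚ] K), (∀ (φ : K →+* ℂ) (x : K), φ (c x) = starRingEnd ℂ (φ x)) ∧
        ∀ᶠ v : HeightOneSpectrum (𝓞 K) in cofinite, ∀ β β' : Multiset ℂ,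
          π'.1.HasSatakeParamAt v β → π'.1.HasSatakeParamAt (c • v) β' →
            β' = β.map (fun a => a⁻¹)) →
      ∀ (ℓ : ℕ) [Fact ℓ.Prime] (ι : PadicAlgCl ℓ ≃+* ℂ) (r : FramedGaloisRep K (PadicAlgCl ℓ) n),
        r.toGaloisRep.IsSemisimple → HarrisLanTaylorThorne2016.IsCompatible π'.1 ι r →
        ∀ (v : HeightOneSpectrum (𝓞 K)), ((ℓ : ℕ) : 𝓞 K) ∉ v.asIdeal →
          ∃ (πv : SmoothIrrep (GL (Fin n) (v.adicCompletion K)))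
            (W : WeilDeligneRep (v.adicCompletion K) (PadicAlgCl ℓ) (Fin n → PadicAlgCl ℓ))
            (Wℂ : WeilDeligneRep (v.adicCompletion K) ℂ (Fin n → ℂ)),
            π'.1.HasLocalComponentAt v πv.ρ ∧
            IsWeilDeligneOfLadic (r.toLocal v).toWeilGroupHom W ∧
            W.IsTransportAlong (ι : PadicAlgCl ℓ →+* ℂ) Wℂ ∧
            Wℂ.HasFrobSemisimpleClass ((𝓛 v).recTwist ((1 - (n : ℂ)) / 2) πv))
    (hK : IsCMField K) {n : ℕ} (hcpt : isCompact_glFiniteIntegralLevel n K)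
    (π' : CuspidalAutomorphicRepData n K hcpt) (hRA : π'.1.IsRegularAlgebraic)
    (hcsd : ∃ (c : K ≃ₐ[ℚ] K), (∀ (φ : K →+* ℂ) (x : K), φ (c x) = starRingEnd ℂ (φ x)) ∧
      ∀ᶠ v : HeightOneSpectrum (𝓞 K) in cofinite, ∀ β β' : Multiset ℂ,
        π'.1.HasSatakeParamAt v β → π'.1.HasSatakeParamAt (c • v) β' → β' = β.map (fun a => a⁻¹))
    (ℓ : ℕ) [Fact ℓ.Prime] (ι : PadicAlgCl ℓ ≃+* ℂ) (r : FramedGaloisRep K (PadicAlgCl ℓ) n)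
    (hr : r.toGaloisRep.IsSemisimple ∧
      ∀ (v : HeightOneSpectrum (𝓞 K)) (β : Multiset ℂ), π'.1.HasSatakeParamAt v β →
        ((ℓ : ℕ) : 𝓞 K) ∉ v.asIdeal →
          r.IsUnramifiedAt v ∧ r.HasFrobCharpolyAt v (arithFrobPolyOfSatake ι v.residueCard n β))
    (hv : ∃ v : HeightOneSpectrum (𝓞 K), ((ℓ : ℕ) : 𝓞 K) ∉ v.asIdeal ∧
      ∃ πv : SmoothIrrep (GL (Fin n) (v.adicCompletion K)), π'.1.HasLocalComponentAt v πv.ρ ∧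
        ∀ (S : WeilDeligneRep (v.adicCompletion K) ℂ (Fin n → ℂ)) (hS : S.IsFrobSemisimple),
          Quotient.mk (frobSemisimpleWDSetoid (v.adicCompletion K) n) ⟨S, hS⟩ =
            (𝓛 v).recTwist ((1 - (n : ℂ)) / 2) πv → S.IsIndecomposable) :
    r.toGaloisRep.IsIrreducible := by
  obtain ⟨v, hvℓ, πv', hπv', hindec⟩ := hv
  have hcompat : HarrisLanTaylorThorne2016.IsCompatible π'.1 ι r :=
    HarrisLanTaylorThorne2016.isCompatible_of_forall_not_mem fun v hv α hα => hr.2 v α hα hv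
  -- (C) at `v`: local component `πv`, `W = WD(r|_v)`, `Wℂ = ι(W)`, class of `Wℂ^{F-ss}`
  obtain ⟨πv, W, Wℂ, hπv, hW, hWℂ, Wℂ', hF, hq⟩ := hC hK hcpt π' hRA hcsd ℓ ι r hr.1 hcompat v hvℓ
  -- local components are unique up to isomorphism, and `recTwist` only sees the class
  have hcl : IrrClass.mk πv = IrrClass.mk πv' :=
    AutomorphicRepData.hasLocalComponentAt_unique_holds π'.1 v πv πv' hπv hπv'
  have hq' : Quotient.mk (frobSemisimpleWDSetoid (v.adicCompletion K) n) ⟨Wℂ', hF.isFrobSemisimple⟩ =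
      (𝓛 v).recTwist ((1 - (n : ℂ)) / 2) πv' := by
    rw [hq]
    simp only [LocalLanglandsDatum.recTwist, hcl]
  have hind : Wℂ'.IsIndecomposable := hindec Wℂ' hF.isFrobSemisimple hq'
  -- L4 ⇒ A1-ind
  have hWind : W.IsIndecomposable :=
    isIndecomposable_of_transport_frobSS (ι : PadicAlgCl ℓ →+* ℂ) W Wℂ Wℂ' hWℂ hF hind
  exact isIrreducible_of_isIndecomposable_weilDeligne r hr.1 v W hW hWind

end Summit.Langlands.Langlands.Theorems.IrreducibleOffSector.SquareIntegrablePlace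

end
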